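import Mathlib
import HarnessLib
import Summits.HubbardSuperconductivity.HubbardSuperconductivity.Theorems.KLProgrammeKLRegimeEngineSliceTelRegimeScalars
import Summits.HubbardSuperconductivity.HubbardSuperconductivity.Theorems.KLProgrammeKLRegimeEngineScaleZeroE1Gfr0
import Summits.HubbardSuperconductivity.HubbardSuperconductivity.Theorems.KLProgrammeH10TwoPointLimitSymbolFrameBand

/-!
# K3 VL child `KLRegimeVolumeLimitV17F2` (stmt-HubbardSuperconductivity-20440), #23 «W2-HALF-VL», brick «W2H-OVL» part 20 (REGIME SCALARS): the scalar facts of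
# the thin-pair telescope — the two scales `Λ_k, Λ_{k+1}` against the majorant `Y = 1/Λ_{k+1}² = 4^{2(k+1)+5}`, the depth window `Y ≤ 4^i`, the cells × step
# length constant, the rate choice `ρ = ρ₃ = 1/(4(Q+1))`, the time rate, and `Gfr_j·U ≤ 2⁻¹²⁰` below `klEngU₀3`

Cell `gate-hubbard-kl`, seat p3 (g15), lead of #23.  Pure real arithmetic used by the «W2H-OVL» regime file (`e₀ = klE0 = 1/32`, `Λ_n = klScale klE0 n`,
`w_n = sectorWidth n = π/2ⁿ`, `N_r = 2^{k+1}`):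

* `thinPair_scale_facts` — positivity, `Λ ≤ 1`, `1/Λ_k, 1/Λ_k², 1/Λ_{k+1} ≤ Y`, `Y = 4^{2(k+1)+5}`, the angular size `(1+6/w_{k+1}) + (1+6/w_k) ≤ 6Y`;
* `thinPair_depth_facts` — for `2(k+1)+5 ≤ i`: `Y ≤ 4^i`, `G₀/(4^i)² ≤ Λ_{k+1}` (`G₀ ≤ 2`), `2^{k+1} + ½ ≤ 4^i`;
* `thinPair_cells_step` — `(ρ_k + ρ_{k+1})·(2^{k+1} + ½) ≤ (5e₀ + s_max Dt_min·15π/4)/(Dt_min − 2A)` and `ρ_n ≤ (e₀ + s_max Dt_min·3π/4)/(Dt_min − 2A)`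
  (`ρ_n = (Λ_n + s_max Dt_min·3w_n/4)/(Dt_min − 2A)`);
* `thinPair_rate_choice` — `ρ = 1/(4(Q+1))`: `π³ρ³Q ≤ 1`, `3π²ρ²Q ≤ 2`;
* `thinPair_time_rate` — `s₀ = Λ_{k+1}β/(Mπ Θ_c)`: `Θ_c·|2π/β|·(1/Λ_{k+1}) ≤ 4/(s₀·2M)`;
* `gfr_mul_le_of_le_klEngU₀3` — `Gfr_j·U ≤ 2⁻¹²⁰` (`j < 5`) for `0 ≤ U ≤ klEngU₀3 P R c`.

No definitions, no sorry. [folklore]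
-/

noncomputable section

namespace Summit.HubbardSuperconductivity.HubbardSuperconductivity.Theorems.TorusFourierL2

set_option linter.dupNamespace false -- summit = problem name (single-conjunct summit), D-0017

open Real Literature.MathematicalPhysics.QuantumLattice Literature.MathematicalPhysics.QuantumLattice.BandSectorCounting Literature.Probability.LatticeModels
open Summit.HubbardSuperconductivity.HubbardSuperconductivity.Theorems.PerturbedFermiCurve
open Summit.HubbardSuperconductivity.HubbardSuperconductivity.Theorems.KLProgrammeLegKernels
open Summit.HubbardSuperconductivity.HubbardSuperconductivity.Theorems.KLRegimeSplit

/-- **The two scales against the majorant `Y = 1/Λ_{k+1}²`.** [folklore] -/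
theorem thinPair_scale_facts (k : ℕ) :
    0 < klScale klE0 k ∧ 0 < klScale klE0 (k + 1) ∧ klScale klE0 k ≤ 1 ∧ klScale klE0 (k + 1) ≤ 1 ∧
      1 ≤ 1 / klScale klE0 (k + 1) ^ 2 ∧ 1 / klScale klE0 k ≤ 1 / klScale klE0 (k + 1) ^ 2 ∧
      1 / klScale klE0 k ^ 2 ≤ 1 / klScale klE0 (k + 1) ^ 2 ∧ 1 / klScale klE0 (k + 1) ≤ 1 / klScale klE0 (k + 1) ^ 2 ∧
      1 / klScale klE0 k ≤ 1 / klScale klE0 (k + 1) ∧ 1 / klScale klE0 (k + 1) ^ 2 = (4 : ℝ) ^ (2 * (k + 1) + 5) ∧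
      (1 + 6 * (sectorWidth (k + 1))⁻¹) + (1 + 6 * (sectorWidth k)⁻¹) ≤ 6 * (1 / klScale klE0 (k + 1) ^ 2) := by
  have hπ := Real.pi_pos
  have hπ3 := Real.pi_gt_three
  have hΛk : klScale klE0 k = (1 / 32) * ((4 : ℝ) ^ k)⁻¹ := by rw [klScale, klE0]
  have hΛk1 : klScale klE0 (k + 1) = (1 / 32) * ((4 : ℝ) ^ (k + 1))⁻¹ := by rw [klScale, klE0]
  have h4k : (1 : ℝ) ≤ (4 : ℝ) ^ k := one_le_pow₀ (by norm_num)
  have h4k1 : (4 : ℝ) ^ (k + 1) = 4 * (4 : ℝ) ^ k := by rw [pow_succ]; ring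
  have hpos : 0 < klScale klE0 k := by rw [hΛk]; positivity
  have hpos1 : 0 < klScale klE0 (k + 1) := by rw [hΛk1]; positivity
  -- closed forms of the inverses
  have hi : 1 / klScale klE0 k = 32 * (4 : ℝ) ^ k := by rw [hΛk]; field_simp
  have hi1 : 1 / klScale klE0 (k + 1) = 128 * (4 : ℝ) ^ k := by rw [hΛk1, h4k1]; field_simp; ring
  have hi2 : 1 / klScale klE0 k ^ 2 = 1024 * ((4 : ℝ) ^ k) ^ 2 := by rw [hΛk]; field_simp; ring
  have hi12 : 1 / klScale klE0 (k + 1) ^ 2 = 16384 * ((4 : ℝ) ^ k) ^ 2 := by rw [hΛk1, h4k1]; field_simp; ring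
  have hsq : (4 : ℝ) ^ k ≤ ((4 : ℝ) ^ k) ^ 2 := by nlinarith only [h4k]
  refine ⟨hpos, hpos1, ?_, ?_, ?_, ?_, ?_, ?_, ?_, ?_, ?_⟩
  · rw [hΛk]; have : ((4 : ℝ) ^ k)⁻¹ ≤ 1 := inv_le_one_of_one_le₀ h4k; nlinarith only [this]
  · rw [hΛk1, h4k1]
    have : (4 * (4 : ℝ) ^ k)⁻¹ ≤ 1 := inv_le_one_of_one_le₀ (by nlinarith only [h4k]); nlinarith only [this]
  · rw [hi12]; nlinarith only [h4k]
  · rw [hi, hi12]; nlinarith only [h4k, hsq]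
  · rw [hi2, hi12]; nlinarith only [h4k]
  · rw [hi1, hi12]; nlinarith only [h4k, hsq]
  · rw [hi, hi1]; nlinarith only [h4k]
  · rw [hi12, show 2 * (k + 1) + 5 = 7 + k * 2 by ring, pow_add, pow_mul]; norm_num
  · have hw : sectorWidth k = π / (2 : ℝ) ^ k := rfl
    have hw1 : sectorWidth (k + 1) = π / (2 : ℝ) ^ (k + 1) := rfl
    rw [hw, hw1, hi12, inv_div, inv_div, pow_succ]
    have h2k : (1 : ℝ) ≤ (2 : ℝ) ^ k := one_le_pow₀ (by norm_num)
    have h24 : (2 : ℝ) ^ k ≤ (4 : ℝ) ^ k := pow_le_pow_left₀ (by norm_num) (by norm_num) k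
    have e1 : 6 * ((2 : ℝ) ^ k * 2 / π) = 12 / π * (2 : ℝ) ^ k := by ring
    have e2 : 6 * ((2 : ℝ) ^ k / π) = 6 / π * (2 : ℝ) ^ k := by ring
    rw [e1, e2]
    have hq : 12 / π ≤ 4 := by rw [div_le_iff₀ hπ]; linarith
    have hq' : 6 / π ≤ 2 := by rw [div_le_iff₀ hπ]; linarith
    have t1 : 12 / π * (2 : ℝ) ^ k ≤ 4 * (4 : ℝ) ^ k := mul_le_mul hq h24 (by positivity) (by norm_num)
    have t2 : 6 / π * (2 : ℝ) ^ k ≤ 2 * (4 : ℝ) ^ k := mul_le_mul hq' h24 (by positivity) (by norm_num)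
    nlinarith only [t1, t2, h4k, hsq]

/-- **The depth window** `2(k+1)+5 ≤ i`: `Y ≤ x = 4^i`, `G₀/x² ≤ Λ_{k+1}` for `G₀ ≤ 2`, `2^{k+1} + ½ ≤ x`, `1 ≤ x`. [folklore] -/
theorem thinPair_depth_facts {k i : ℕ} (hi : 2 * (k + 1) + 5 ≤ i) {G₀ : ℝ} (hG₀2 : G₀ ≤ 2) :
    1 / klScale klE0 (k + 1) ^ 2 ≤ (4 : ℝ) ^ i ∧ (1 : ℝ) ≤ (4 : ℝ) ^ i ∧ G₀ / ((4 : ℝ) ^ i) ^ 2 ≤ klScale klE0 (k + 1) ∧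
      (2 : ℝ) ^ (k + 1) + 1 / 2 ≤ (4 : ℝ) ^ i := by
  obtain ⟨-, hpos1, -, -, hY1, -, -, -, -, hYeq, -⟩ := thinPair_scale_facts k
  have hYx : 1 / klScale klE0 (k + 1) ^ 2 ≤ (4 : ℝ) ^ i := by rw [hYeq]; exact pow_le_pow_right₀ (by norm_num) hi
  have hx1 : (1 : ℝ) ≤ (4 : ℝ) ^ i := hY1.trans hYx
  refine ⟨hYx, hx1, ?_, ?_⟩
  · -- `G₀/x² ≤ 2/(Y·x) ≤ 2Λ²... `: use `x ≥ Y = 1/Λ²` twice: `G₀/x² ≤ 2/Y² = 2Λ⁴ ≤ Λ`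
    have hx0 : 0 < (4 : ℝ) ^ i := by positivity
    have hΛle : klScale klE0 (k + 1) ≤ 1 / 32 := by
      rw [klScale, klE0]
      have : ((4 : ℝ) ^ (k + 1))⁻¹ ≤ 1 := inv_le_one_of_one_le₀ (one_le_pow₀ (by norm_num))
      nlinarith only [this]
    have h1 : G₀ / ((4 : ℝ) ^ i) ^ 2 ≤ 2 / (1 / klScale klE0 (k + 1) ^ 2) ^ 2 := by
      have hY0 : 0 < 1 / klScale klE0 (k + 1) ^ 2 := by positivity
      exact div_le_div₀ (by norm_num) hG₀2 (by positivity) (pow_le_pow_left₀ hY0.le hYx 2)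
    have h2 : 2 / (1 / klScale klE0 (k + 1) ^ 2) ^ 2 = 2 * klScale klE0 (k + 1) ^ 4 := by
      field_simp
    rw [h2] at h1
    refine h1.trans ?_
    have hΛ0 := hpos1.le
    calc 2 * klScale klE0 (k + 1) ^ 4 = klScale klE0 (k + 1) * (2 * klScale klE0 (k + 1) ^ 3) := by ring
      _ ≤ klScale klE0 (k + 1) * 1 := by
          refine mul_le_mul_of_nonneg_left ?_ hΛ0
          have h3 : klScale klE0 (k + 1) ^ 3 ≤ (1 / 32) ^ 3 := pow_le_pow_left₀ hΛ0 hΛle 3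
          norm_num at h3
          linarith
      _ = klScale klE0 (k + 1) := mul_one _
  · have h24 : (2 : ℝ) ^ (k + 1) ≤ (4 : ℝ) ^ (k + 1) := pow_le_pow_left₀ (by norm_num) (by norm_num) (k + 1)
    have h44 : (4 : ℝ) ^ (k + 1) ≤ (4 : ℝ) ^ (2 * (k + 1) + 4) := pow_le_pow_right₀ (by norm_num) (by omega)
    have h45 : (4 : ℝ) ^ (2 * (k + 1) + 5) ≤ (4 : ℝ) ^ i := pow_le_pow_right₀ (by norm_num) hi
    have e : (4 : ℝ) ^ (2 * (k + 1) + 5) = 4 * (4 : ℝ) ^ (2 * (k + 1) + 4) := by rw [pow_succ]; ring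
    have h1 : (1 : ℝ) ≤ (4 : ℝ) ^ (2 * (k + 1) + 4) := one_le_pow₀ (by norm_num)
    nlinarith only [h24, h44, h45, e, h1]

/-- **Cells × step length**: with `ρ_n = (Λ_n + s_max Dt_min (3w_n/4))/(Dt_min − 2A)`,
`(ρ_k + ρ_{k+1})·(2^{k+1} + ½) ≤ (5e₀ + s_max Dt_min (15π/4))/(Dt_min − 2A)` and `ρ_n ≤ (e₀ + s_max Dt_min (3π/4))/(Dt_min − 2A)` (`n = k, k+1`). [folklore] -/
theorem thinPair_cells_step {a b : ℝ} (B : BandBounds a b) {A : ℝ} (hADt : 2 * A < B.Dtmin) (k : ℕ) :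
    ((klScale klE0 k + B.smax * B.Dtmin * (3 * sectorWidth k / 4)) / (B.Dtmin - 2 * A) +
        (klScale klE0 (k + 1) + B.smax * B.Dtmin * (3 * sectorWidth (k + 1) / 4)) / (B.Dtmin - 2 * A)) * ((2 : ℝ) ^ (k + 1) + 1 / 2) ≤
      (5 * klE0 + B.smax * B.Dtmin * (15 * π / 4)) / (B.Dtmin - 2 * A) ∧
    (klScale klE0 k + B.smax * B.Dtmin * (3 * sectorWidth k / 4)) / (B.Dtmin - 2 * A) ≤ (klE0 + B.smax * B.Dtmin * (3 * π / 4)) / (B.Dtmin - 2 * A) ∧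
    (klScale klE0 (k + 1) + B.smax * B.Dtmin * (3 * sectorWidth (k + 1) / 4)) / (B.Dtmin - 2 * A) ≤
      (klE0 + B.smax * B.Dtmin * (3 * π / 4)) / (B.Dtmin - 2 * A) ∧
    0 ≤ (klScale klE0 k + B.smax * B.Dtmin * (3 * sectorWidth k / 4)) / (B.Dtmin - 2 * A) ∧
    0 ≤ (klScale klE0 (k + 1) + B.smax * B.Dtmin * (3 * sectorWidth (k + 1) / 4)) / (B.Dtmin - 2 * A) := by
  have hπ := Real.pi_pos
  have hDt : 0 < B.Dtmin - 2 * A := by linarith only [hADt]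
  have hsm := B.smax_pos
  have hDt0 := B.Dtmin_pos
  have he : (0 : ℝ) < klE0 := by norm_num [klE0]
  have hΛk : klScale klE0 k = klE0 * ((4 : ℝ) ^ k)⁻¹ := by rw [klScale]
  have hΛk1 : klScale klE0 (k + 1) = klE0 * ((4 : ℝ) ^ (k + 1))⁻¹ := by rw [klScale]
  have hw : sectorWidth k = π / (2 : ℝ) ^ k := rfl
  have hw1 : sectorWidth (k + 1) = π / (2 : ℝ) ^ (k + 1) := rfl
  have h2k : (1 : ℝ) ≤ (2 : ℝ) ^ k := one_le_pow₀ (by norm_num)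
  have h4k : (1 : ℝ) ≤ (4 : ℝ) ^ k := one_le_pow₀ (by norm_num)
  have hΛe : ∀ n, klScale klE0 n ≤ klE0 := fun n => klScale_le_e0 he.le n
  have hwle : ∀ n, sectorWidth n ≤ π := fun n => by
    show π / (2 : ℝ) ^ n ≤ π
    exact div_le_self hπ.le (one_le_pow₀ (by norm_num))
  have hΛ0 : ∀ n, 0 ≤ klScale klE0 n := fun n => (klth_klScale_pos n).le
  have hw0 : ∀ n, 0 ≤ sectorWidth n := fun n => (sectorWidth_pos n).le
  -- the products with the step length
  have p1 : klScale klE0 k * ((2 : ℝ) ^ (k + 1) + 1 / 2) ≤ 5 / 2 * klE0 := by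
    rw [hΛk, pow_succ]
    have h24 : (2 : ℝ) ^ k ≤ (4 : ℝ) ^ k := pow_le_pow_left₀ (by norm_num) (by norm_num) k
    have hinv : 0 < ((4 : ℝ) ^ k)⁻¹ := by positivity
    have e : klE0 * ((4 : ℝ) ^ k)⁻¹ * ((2 : ℝ) ^ k * 2 + 1 / 2) = klE0 * (2 * ((2 : ℝ) ^ k * ((4 : ℝ) ^ k)⁻¹) + 1 / 2 * ((4 : ℝ) ^ k)⁻¹) := by ring
    rw [e]
    have u1 : (2 : ℝ) ^ k * ((4 : ℝ) ^ k)⁻¹ ≤ 1 := by rw [← div_eq_mul_inv, div_le_one (by positivity)]; exact h24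
    have u2 : ((4 : ℝ) ^ k)⁻¹ ≤ 1 := inv_le_one_of_one_le₀ h4k
    nlinarith only [u1, u2, he]
  have p2 : klScale klE0 (k + 1) * ((2 : ℝ) ^ (k + 1) + 1 / 2) ≤ 5 / 2 * klE0 := by
    have hmono : klScale klE0 (k + 1) ≤ klScale klE0 k := by
      rw [hΛk, hΛk1]; refine mul_le_mul_of_nonneg_left ?_ he.le
      exact inv_anti₀ (by positivity) (pow_le_pow_right₀ (by norm_num) (Nat.le_succ k))
    exact (mul_le_mul_of_nonneg_right hmono (by positivity)).trans p1
  have p3 : sectorWidth k * ((2 : ℝ) ^ (k + 1) + 1 / 2) ≤ 5 / 2 * π := by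
    rw [hw, pow_succ]
    have e : π / (2 : ℝ) ^ k * ((2 : ℝ) ^ k * 2 + 1 / 2) = π * (2 + 1 / 2 * ((2 : ℝ) ^ k)⁻¹) := by field_simp
    rw [e]
    have u2 : ((2 : ℝ) ^ k)⁻¹ ≤ 1 := inv_le_one_of_one_le₀ h2k
    nlinarith only [u2, hπ]
  have p4 : sectorWidth (k + 1) * ((2 : ℝ) ^ (k + 1) + 1 / 2) ≤ 5 / 4 * π := by
    rw [hw1]
    have h2k1 : (0 : ℝ) < (2 : ℝ) ^ (k + 1) := by positivity
    have e : π / (2 : ℝ) ^ (k + 1) * ((2 : ℝ) ^ (k + 1) + 1 / 2) = π * (1 + 1 / 2 * ((2 : ℝ) ^ (k + 1))⁻¹) := by field_simp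
    rw [e]
    have u2 : ((2 : ℝ) ^ (k + 1))⁻¹ ≤ 1 / 2 := by
      rw [pow_succ]; have : (2 : ℝ) ≤ (2 : ℝ) ^ k * 2 := by nlinarith only [h2k]
      calc ((2 : ℝ) ^ k * 2)⁻¹ ≤ (2 : ℝ)⁻¹ := inv_anti₀ (by norm_num) this
        _ = 1 / 2 := by norm_num
    nlinarith only [u2, hπ]
  have hn0 : ∀ n, 0 ≤ klScale klE0 n + B.smax * B.Dtmin * (3 * sectorWidth n / 4) := fun n => by
    have := hΛ0 n; have := hw0 n; positivity
  refine ⟨?_, ?_, ?_, div_nonneg (hn0 k) hDt.le, div_nonneg (hn0 (k + 1)) hDt.le⟩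
  · rw [← add_div, div_mul_eq_mul_div]
    refine div_le_div_of_nonneg_right ?_ hDt.le
    have e : (klScale klE0 k + B.smax * B.Dtmin * (3 * sectorWidth k / 4) + (klScale klE0 (k + 1) + B.smax * B.Dtmin * (3 * sectorWidth (k + 1) / 4))) *
        ((2 : ℝ) ^ (k + 1) + 1 / 2) =
        klScale klE0 k * ((2 : ℝ) ^ (k + 1) + 1 / 2) + klScale klE0 (k + 1) * ((2 : ℝ) ^ (k + 1) + 1 / 2) +
          B.smax * B.Dtmin * (3 / 4) * (sectorWidth k * ((2 : ℝ) ^ (k + 1) + 1 / 2) + sectorWidth (k + 1) * ((2 : ℝ) ^ (k + 1) + 1 / 2)) := by ring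
    rw [e]
    have hsd : 0 ≤ B.smax * B.Dtmin * (3 / 4) := by positivity
    have q := mul_le_mul_of_nonneg_left (add_le_add p3 p4) hsd
    have hsp : 0 ≤ B.smax * B.Dtmin * π := by positivity
    nlinarith only [p1, p2, q, hsp]
  · exact div_le_div_of_nonneg_right (by nlinarith only [hΛe k, hwle k, mul_pos hsm hDt0]) hDt.le
  · exact div_le_div_of_nonneg_right (by nlinarith only [hΛe (k + 1), hwle (k + 1), mul_pos hsm hDt0]) hDt.le

/-- **The rate choice** `ρ = 1/(4(Q+1))` (`Q ≥ 0`): `0 < ρ`, `π³ρ³Q ≤ 1`, `3π²ρ²Q ≤ 2`. [folklore] -/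
theorem thinPair_rate_choice {Q : ℝ} (hQ : 0 ≤ Q) :
    0 < 1 / (4 * (Q + 1)) ∧ π ^ 3 * (1 / (4 * (Q + 1))) ^ 3 * Q ≤ 1 ∧ 3 * π ^ 2 * (1 / (4 * (Q + 1))) ^ 2 * Q ≤ 2 := by
  have hπ := Real.pi_pos
  have hπ4 : π < 4 := by linarith [Real.pi_lt_d2]
  have hQ1 : 0 < Q + 1 := by linarith
  refine ⟨by positivity, ?_, ?_⟩
  · have hq : Q / (Q + 1) ^ 3 ≤ 1 := by
      rw [div_le_one (by positivity)]; nlinarith [sq_nonneg Q, mul_nonneg hQ (sq_nonneg Q)]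
    have e : π ^ 3 * (1 / (4 * (Q + 1))) ^ 3 * Q = (π / 4) ^ 3 * (Q / (Q + 1) ^ 3) := by field_simp
    rw [e]
    have h1 : (π / 4) ^ 3 ≤ 1 := pow_le_one₀ (by positivity) (by rw [div_le_one (by norm_num)]; exact hπ4.le)
    calc (π / 4) ^ 3 * (Q / (Q + 1) ^ 3) ≤ 1 * 1 := mul_le_mul h1 hq (by positivity) zero_le_one
      _ = 1 := one_mul _
  · have hq : Q / (Q + 1) ^ 2 ≤ 1 := by
      rw [div_le_one (by positivity)]; nlinarith [sq_nonneg Q]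
    have e : 3 * π ^ 2 * (1 / (4 * (Q + 1))) ^ 2 * Q = 3 / 16 * π ^ 2 * (Q / (Q + 1) ^ 2) := by field_simp; ring
    rw [e]
    have hπsq : π ^ 2 < 32 / 3 := by nlinarith [Real.pi_lt_d2, hπ]
    have h2 : 3 / 16 * π ^ 2 * (Q / (Q + 1) ^ 2) ≤ 3 / 16 * π ^ 2 * 1 := mul_le_mul_of_nonneg_left hq (by positivity)
    linarith

/-- **The time rate** `s₀ = Λ_{k+1}β/(Mπ Θ_c)`: `0 < s₀` and `Θ_c·|2π/β|·(1/Λ_{k+1}) ≤ 4/(s₀·2M)` (in fact equality). [folklore] -/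
theorem thinPair_time_rate {β : ℝ} (hβ : 0 < β) {M : ℕ} [NeZero M] {Θc : ℝ} (hΘc : 0 < Θc) (k : ℕ) :
    0 < klScale klE0 (k + 1) * β / (M * π * Θc) ∧
      Θc * |2 * π / β| * (1 / klScale klE0 (k + 1)) ≤ 4 / (klScale klE0 (k + 1) * β / (M * π * Θc) * (2 * M : ℕ)) := by
  have hπ := Real.pi_pos
  have hM : (0 : ℝ) < M := Nat.cast_pos.2 (Nat.pos_of_ne_zero (NeZero.ne M))
  have hΛ := klth_klScale_pos (k + 1)
  refine ⟨by positivity, le_of_eq ?_⟩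
  rw [abs_of_pos (by positivity)]
  push_cast
  field_simp
  ring

/-- **`Gfr_j·U ≤ 2⁻¹²⁰`** for `0 ≤ U ≤ klEngU₀3 P R c`, `j < 5` (`Gfr_j ≤ klEngRsq R`). [folklore] -/
theorem gfr_mul_le_of_le_klEngU₀3 (P : SplitConsts) {R : RenConsts} {c U : ℝ} (hU : 0 ≤ U)
    (hU₀ : U ≤ EngineV8.klEngU₀3 P R c) {j : ℕ} (hj : j < 5) : R.Gfr j * U ≤ 1 / (2 : ℝ) ^ 120 := by
  have hRsq1 : 1 ≤ EngineV8.klEngRsq R := EngineV8.one_le_klEngRsq R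
  have hPsq1 : 1 ≤ EngineV8.klEngPsq P := EngineV8.one_le_klEngPsq P
  have hG : R.Gfr j ≤ EngineV8.klEngRsq R := EngineV8.gfr_le_klEngRsq R hj
  have hden : (2 : ℝ) ^ 120 * EngineV8.klEngRsq R ≤ (2 : ℝ) ^ 120 * EngineV8.klEngPsq P ^ 2 * EngineV8.klEngRsq R ^ 4 * (c ^ 2 + 1) := by
    have h1 : EngineV8.klEngRsq R ≤ EngineV8.klEngRsq R ^ 4 := by
      calc EngineV8.klEngRsq R = EngineV8.klEngRsq R * 1 * 1 * 1 := by ring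
        _ ≤ EngineV8.klEngRsq R * EngineV8.klEngRsq R * EngineV8.klEngRsq R * EngineV8.klEngRsq R := by gcongr
        _ = EngineV8.klEngRsq R ^ 4 := by ring
    have h2 : (1 : ℝ) ≤ EngineV8.klEngPsq P ^ 2 := one_le_pow₀ hPsq1
    have h3 : (1 : ℝ) ≤ c ^ 2 + 1 := by nlinarith [sq_nonneg c]
    have hR0 : 0 ≤ EngineV8.klEngRsq R := by linarith
    calc (2 : ℝ) ^ 120 * EngineV8.klEngRsq R = (2 : ℝ) ^ 120 * 1 * EngineV8.klEngRsq R * 1 := by ring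
      _ ≤ (2 : ℝ) ^ 120 * EngineV8.klEngPsq P ^ 2 * EngineV8.klEngRsq R ^ 4 * (c ^ 2 + 1) := by gcongr
  have hUle : U ≤ 1 / ((2 : ℝ) ^ 120 * EngineV8.klEngRsq R) := by
    refine hU₀.trans ?_
    rw [EngineV8.klEngU₀3]
    exact one_div_le_one_div_of_le (by positivity) hden
  have hGU : R.Gfr j * U ≤ EngineV8.klEngRsq R * (1 / ((2 : ℝ) ^ 120 * EngineV8.klEngRsq R)) := mul_le_mul hG hUle hU (by linarith)
  have hval : EngineV8.klEngRsq R * (1 / ((2 : ℝ) ^ 120 * EngineV8.klEngRsq R)) = 1 / (2 : ℝ) ^ 120 := by field_simp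
  rwa [hval] at hGU

end Summit.HubbardSuperconductivity.HubbardSuperconductivity.Theorems.TorusFourierL2

end
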